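import Mathlib
import Summits.Ventures.PercRepro2.Defs
import Summits.Ventures.PercRepro2.Graph
import Summits.Ventures.PercRepro2.Events
import Summits.Ventures.PercRepro2.Harris
import Summits.Ventures.PercRepro2.PinnedLaw
import Summits.Ventures.PercRepro2.CycleConn
import Summits.Ventures.PercRepro2.XWForm

/-!
# (XW) on the 4-cycle for every weight vector and every placement of four distinct marks
(PercRepro2, p2 g24)

The base case of the cycle theorem of the (XW) line.  (XW) is `0 ≤ xwBil ends s y o u p p` with
`a = {s ↔ u}`, `λ = {y ↔ o}`, `S = {s ↔ y}` (`XWForm.lean`).  By the pin induction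
`xw_of_xwbern` (p2 g22) it suffices that every antipodal (tensor-Bernstein) coefficient
`xwAnti ends s y o u p F` is nonnegative at every point mass `p ∈ {0,1}^E` — an INTEGER
statement about the `2^{|F|}` two-colourings of the free edges `F` of the contracted/deleted
multigraph.  On the `4`-cycle `cycN 4` this integer statement is a finite computation:

* `connB ω u v` is connectivity on the `4`-cycle as a `Bool` (`u ↔ v` iff one of the two arcs
  between them is fully open, `conn_cycle_iff`); `connB_spec` identifies it with `Conn (cycN 4)`
  (the `256` cases decided);
* `xwZ s y o u X Y ∈ ℤ` is the bilinear form `B_W(X, Y)` at two point masses, `xwAntiZ` the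
  antipodal sum `∑_η B_W(ζ[F ↦ η], ζ[F ↦ !η])`; `xwBil_pinned_eq` / `xwAnti_pinned_eq` are the
  bridges `xwBil p q = xwZ (pinnedConfig p) (pinnedConfig q)` for pinned weight vectors
  (`prob_eq_indicator_of_pinned`) and `pinnedConfig (pinOn p F η) = mix (pinnedConfig p) F η`;
* **`xwAntiZ_nonneg`**: all `81` antipodal coefficients are `≥ 0` for each of the `24`
  placements of four distinct marks on `C₄` (one kernel `decide`: `24 · 81` colouring sums);
* **`xw_cycle4`**: `0 ≤ xwBil (cycN 4) s y o u p p` for every admissible `p` and four distinct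
  marks — the `C₄` certificate of the (XW) line (P2-G23-XW.md §8: all 81 Bernstein coefficients
  of the 4-cycle are nonnegative for each of the three cyclic orders; here every placement).
-/

namespace Summit.Ventures.PercRepro2

namespace XWCycleFour

open Cycle

/-! ## Connectivity on the 4-cycle as a Boolean -/

/-- Connectivity on the `4`-cycle, decided through the two arcs. -/
def connB (ω : Config (Fin 4)) (u v : Fin 4) : Bool :=
  decide ((∀ i ∈ upInterval u v, ω i = true) ∨ (∀ i ∈ upInterval v u, ω i = true))

/-- `connB` is connectivity on the `4`-cycle. -/
lemma conn_iff_connB (ω : Config (Fin 4)) (u v : Fin 4) :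
    Conn (cycN 4) ω u v ↔ connB ω u v = true := by
  rw [connB, decide_eq_true_iff, conn_cycle_iff]

/-- Membership in a connection event of the `4`-cycle, as a Boolean. -/
lemma mem_connEvent_iff (ω : Config (Fin 4)) (u v : Fin 4) :
    ω ∈ connEvent (cycN 4) u v ↔ connB ω u v = true :=
  conn_iff_connB ω u v

/-! ## The integer form of `B_W` at point masses -/

/-- The indicator of a Boolean, in `ℤ`. -/
def indZ (b : Bool) : ℤ := if b then 1 else 0

/-- `B_W(X, Y)` at two point masses `X, Y`, in `ℤ`:
`[aλ]_X + [Sa]_X [Sλ]_Y − [a]_X [λ]_Y − [S]_X [Saλ]_Y`. -/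
def xwZ (s y o u : Fin 4) (X Y : Config (Fin 4)) : ℤ :=
  indZ (connB X s u && connB X y o) +
    indZ (connB X s y && connB X s u) * indZ (connB Y s y && connB Y y o) -
    indZ (connB X s u) * indZ (connB Y y o) -
    indZ (connB X s y) * indZ (connB Y s y && connB Y s u && connB Y y o)

/-- The configuration `ζ` overwritten by `η` on `F`. -/
def mix (ζ : Config (Fin 4)) (F : Finset (Fin 4)) (η : Config (Fin 4)) : Config (Fin 4) :=
  fun e => if e ∈ F then η e else ζ e

/-- The antipodal coefficient at the point mass `ζ` on the free edges `F`, in `ℤ`: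
`∑_η B_W(ζ[F ↦ η], ζ[F ↦ !η])`. -/
def xwAntiZ (s y o u : Fin 4) (ζ : Config (Fin 4)) (F : Finset (Fin 4)) : ℤ :=
  ∑ η : Config (Fin 4), xwZ s y o u (mix ζ F η) (mix ζ F (fun e => !η e))

/-- `mix` does not see `ζ` on `F`. -/
lemma mix_eq_mix_erase (ζ : Config (Fin 4)) (F : Finset (Fin 4)) (η : Config (Fin 4)) :
    mix ζ F η = mix (fun e => if e ∈ F then false else ζ e) F η := by
  funext e
  by_cases he : e ∈ F <;> simp [mix, he]

/-- `xwAntiZ` does not see `ζ` on `F`. -/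
lemma xwAntiZ_eq_erase (s y o u : Fin 4) (ζ : Config (Fin 4)) (F : Finset (Fin 4)) :
    xwAntiZ s y o u ζ F = xwAntiZ s y o u (fun e => if e ∈ F then false else ζ e) F := by
  unfold xwAntiZ
  refine Finset.sum_congr rfl fun η _ => ?_
  rw [mix_eq_mix_erase ζ F η, mix_eq_mix_erase ζ F (fun e => !η e)]

/-! ## The finite check: all antipodal coefficients of `C₄` are nonnegative -/

/-- **The `C₄` certificate, restricted form**: for four distinct marks, every antipodal
coefficient with `ζ` vanishing on `F` is nonnegative (decided: `24 · 81` colouring sums). -/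
theorem xwAntiZ_nonneg_of_false_on (s y o u : Fin 4) (hsy : s ≠ y) (hso : s ≠ o)
    (hsu : s ≠ u) (hyo : y ≠ o) (hyu : y ≠ u) (hou : o ≠ u) (F : Finset (Fin 4))
    (ζ : Config (Fin 4)) (hζ : ∀ e ∈ F, ζ e = false) : 0 ≤ xwAntiZ s y o u ζ F := by
  revert s y o u F ζ
  decide +kernel

/-- **The `C₄` certificate**: for four distinct marks every antipodal coefficient is nonnegative. -/
theorem xwAntiZ_nonneg (s y o u : Fin 4) (hsy : s ≠ y) (hso : s ≠ o) (hsu : s ≠ u)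
    (hyo : y ≠ o) (hyu : y ≠ u) (hou : o ≠ u) (ζ : Config (Fin 4)) (F : Finset (Fin 4)) :
    0 ≤ xwAntiZ s y o u ζ F := by
  rw [xwAntiZ_eq_erase]
  exact xwAntiZ_nonneg_of_false_on s y o u hsy hso hsu hyo hyu hou F _ (fun e he => by simp [he])

/-! ## Bridges from the ring-valued forms to the integer forms -/

section Bridge

variable {R : Type*} [CommRing R] [Nontrivial R]

/-- The probability of an event under a pinned weight vector is the indicator of the forced
configuration, written through a Boolean. -/
lemma prob_pinned_eq_indZ {p : Fin 4 → R} (hp : Pinned.IsPinned p) (A : Set (Config (Fin 4)))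
    (b : Bool) (hb : Pinned.pinnedConfig p ∈ A ↔ b = true) :
    prob p A = ((indZ b : ℤ) : R) := by
  classical
  rw [Pinned.prob_eq_indicator_of_pinned hp, Set.indicator_apply]
  cases b
  · rw [if_neg (fun h => by simpa using hb.1 h)]
    simp [indZ]
  · rw [if_pos (hb.2 rfl)]
    simp [indZ]

/-- Membership in an intersection of two connection events, as a Boolean. -/
lemma mem_inter2_iff (ω : Config (Fin 4)) (a b c d : Fin 4) :
    ω ∈ connEvent (cycN 4) a b ∩ connEvent (cycN 4) c d ↔
      (connB ω a b && connB ω c d) = true := by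
  simp only [Set.mem_inter_iff, mem_connEvent_iff, Bool.and_eq_true]

/-- Membership in an intersection of three connection events, as a Boolean. -/
lemma mem_inter3_iff (ω : Config (Fin 4)) (a b c d e f : Fin 4) :
    ω ∈ connEvent (cycN 4) a b ∩ connEvent (cycN 4) c d ∩ connEvent (cycN 4) e f ↔
      (connB ω a b && connB ω c d && connB ω e f) = true := by
  simp only [Set.mem_inter_iff, mem_connEvent_iff, Bool.and_eq_true]

/-- **`B_W` at two pinned weight vectors is the integer form at the forced configurations.** -/
lemma xwBil_pinned_eq {p q : Fin 4 → R} (hp : Pinned.IsPinned p) (hq : Pinned.IsPinned q)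
    (s y o u : Fin 4) :
    xwBil (cycN 4) s y o u p q =
      ((xwZ s y o u (Pinned.pinnedConfig p) (Pinned.pinnedConfig q) : ℤ) : R) := by
  unfold xwBil xwZ
  rw [prob_pinned_eq_indZ hp _ _ (mem_inter2_iff _ s u y o),
    prob_pinned_eq_indZ hp _ _ (mem_inter2_iff _ s y s u),
    prob_pinned_eq_indZ hq _ _ (mem_inter2_iff _ s y y o),
    prob_pinned_eq_indZ hp _ _ (mem_connEvent_iff _ s u),
    prob_pinned_eq_indZ hq _ _ (mem_connEvent_iff _ y o),
    prob_pinned_eq_indZ hp _ _ (mem_connEvent_iff _ s y),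
    prob_pinned_eq_indZ hq _ _ (mem_inter3_iff _ s y s u y o)]
  push_cast
  ring

/-- Pinning on `F` keeps a pinned vector pinned. -/
lemma isPinned_pinOn {p : Fin 4 → R} (hp : Pinned.IsPinned p) (F : Finset (Fin 4))
    (η : Config (Fin 4)) : Pinned.IsPinned (pinOn p F η) := by
  intro e
  by_cases he : e ∈ F
  · cases η e <;> simp [pinOn, he]
  · simp only [pinOn, he, if_false]
    exact hp e

/-- The forced configuration of `pinOn p F η` is `pinnedConfig p` overwritten by `η` on `F`. -/
lemma pinnedConfig_pinOn {p : Fin 4 → R} (F : Finset (Fin 4)) (η : Config (Fin 4)) :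
    Pinned.pinnedConfig (pinOn p F η) = mix (Pinned.pinnedConfig p) F η := by
  funext e
  by_cases he : e ∈ F
  · cases hη : η e <;> simp [Pinned.pinnedConfig, pinOn, mix, he, hη]
  · simp [Pinned.pinnedConfig, pinOn, mix, he]

end Bridge

section BridgeOrdered

variable {R : Type*} [CommRing R] [LinearOrder R] [IsStrictOrderedRing R]

/-- **The antipodal coefficient at a pinned weight vector is the integer antipodal sum.** -/
lemma xwAnti_pinned_eq {p : Fin 4 → R} (hp : Pinned.IsPinned p) (s y o u : Fin 4)
    (F : Finset (Fin 4)) :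
    xwAnti (cycN 4) s y o u p F = ((xwAntiZ s y o u (Pinned.pinnedConfig p) F : ℤ) : R) := by
  unfold xwAnti xwAntiZ
  push_cast
  refine Finset.sum_congr rfl fun η _ => ?_
  rw [xwBil_pinned_eq (isPinned_pinOn hp F η) (isPinned_pinOn hp F _), pinnedConfig_pinOn,
    pinnedConfig_pinOn]

/-- **(XW) on the `4`-cycle for every admissible weight vector and every placement of four
distinct marks** (the `C₄` certificate through the pin induction `xw_of_xwbern`). -/
theorem xw_cycle4 (p : Fin 4 → R) (hp : IsProbVec p) (s y o u : Fin 4) (hsy : s ≠ y)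
    (hso : s ≠ o) (hsu : s ≠ u) (hyo : y ≠ o) (hyu : y ≠ u) (hou : o ≠ u) :
    0 ≤ xwBil (cycN 4) s y o u p p := by
  refine xw_of_xwbern (cycN 4) s y o u ?_ p hp
  intro q _ hpin F
  rw [xwAnti_pinned_eq hpin]
  exact_mod_cast xwAntiZ_nonneg s y o u hsy hso hsu hyo hyu hou (Pinned.pinnedConfig q) F

end BridgeOrdered

end XWCycleFour

end Summit.Ventures.PercRepro2
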